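import Summits.ValiantsHypothesis.ValiantsHypothesis.Theorems.FeketeSOSHard.Negative.LoadBearing

/-!
# `FeketeSOS.FeketeSOSHard` (stmt-ValiantsHypothesis-3996) — negative side: the kill criterion

Standing disprover (cdisprove, cycle 1), from `Cruxes/FeketeSOSHard/Disproof.lean` §(b) (digit-rank remark).
What a refutation of the crux must produce, as a theorem: few cheap PRODUCTS suffice.

* `sos_of_products` — `∑_{l<r} A_l B_l` is a weighted sum of `r + r` squares `(A_l ± B_l)` with weights `±1/4`,
  support-sum `≤ 2 ∑_l (|supp A_l| + |supp B_l|)` and degrees bounded by those of the factors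
  (the `r`-fold version of `LoadBearing.sqg_sum`).
* `feketeSOSHard_false_of_cheapProducts` — hence: if for every `δ > 0` there are arbitrarily large primes `p`
  with `F_p = ∑_{l<r} A_l B_l`, `r + r ≤ p^δ`, `deg A_l, deg B_l ≤ p²` and `2 ∑_l (|supp A_l| + |supp B_l|) < p^{1/2+δ}`,
  then `¬ FeketeSOSHard`.  A rank-`r` factorisation of a tiling matrix `(χ_p(1+u+v))_{u∈S₁, v∈S₂}`
  (`S₁ + S₂ ⊇ [0, p-2]`) is exactly such a family with `|supp A_l| ≤ |S₁|`, `|supp B_l| ≤ |S₂|`; the measured ranks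
  (Disproof.lean `digitRank_remark`) are `≈ min(|S₁|,|S₂|)`, so no instance is known — this file only pins the TARGET
  of any future counterexample search. [folklore]
-/

namespace Summit.ValiantsHypothesis.ValiantsHypothesis.Theorems.FeketeSOSHard.Negative

open Polynomial Finset
open Summit.ValiantsHypothesis.ValiantsHypothesis.Theses.FeketeSOS

noncomputable section

/-- The `r + r` polynomials `A_l + B_l` (first block) and `A_l − B_l` (second block). [folklore] -/
def prodG {r : ℕ} (A B : Fin r → ℂ[X]) : Fin (r + r) → ℂ[X] :=
  Fin.append (fun l => A l + B l) (fun l => A l - B l)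

/-- The weights `1/4` (first block) and `−1/4` (second block). [folklore] -/
def prodC (r : ℕ) : Fin (r + r) → ℂ :=
  Fin.append (fun _ : Fin r => (1 / 4 : ℂ)) (fun _ : Fin r => (-1 / 4 : ℂ))

/-- `∑_l A_l B_l = ∑_l ¼(A_l+B_l)² − ∑_l ¼(A_l−B_l)²` in the crux's format `∑ C(c i) * g i ^ 2`. -/
theorem prodG_sum {r : ℕ} (A B : Fin r → ℂ[X]) :
    (∑ i, C (prodC r i) * prodG A B i ^ 2) = ∑ l, A l * B l := by
  rw [Fin.sum_univ_add]
  simp only [prodC, prodG, Fin.append_left, Fin.append_right]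
  rw [← sum_add_distrib]
  refine sum_congr rfl fun l _ => ?_
  have h := sqg_sum (A l) (B l) 0 0
  simp only [Fin.sum_univ_four, sqg, sqc, Matrix.cons_val_zero, Matrix.cons_val_one, Matrix.cons_val_two,
    Matrix.cons_val_three, Matrix.head_cons, Matrix.tail_cons, add_zero, sub_zero, mul_zero] at h
  linear_combination h

/-- Support-sum of the `r + r` squares is at most twice the supports of the factors. -/
theorem prodG_support {r : ℕ} (A B : Fin r → ℂ[X]) :
    (∑ i, ((prodG A B i).support.card : ℝ)) ≤ 2 * ∑ l, (((A l).support.card : ℝ) + (B l).support.card) := by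
  rw [Fin.sum_univ_add]
  simp only [prodG, Fin.append_left, Fin.append_right]
  have h1 : ∀ l, (((A l + B l).support.card : ℕ) : ℝ) ≤ (A l).support.card + (B l).support.card := fun l => by
    exact_mod_cast card_support_add_le (A l) (B l)
  have h2 : ∀ l, (((A l - B l).support.card : ℕ) : ℝ) ≤ (A l).support.card + (B l).support.card := fun l => by
    exact_mod_cast card_support_sub_le (A l) (B l)
  have s1 := sum_le_sum fun l (_ : l ∈ univ) => h1 l
  have s2 := sum_le_sum fun l (_ : l ∈ univ) => h2 l
  linarith

/-- Degrees of the `r + r` squares are bounded by a common bound on the factors. -/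
theorem prodG_natDegree {r : ℕ} (A B : Fin r → ℂ[X]) (D : ℕ) (hA : ∀ l, (A l).natDegree ≤ D)
    (hB : ∀ l, (B l).natDegree ≤ D) : ∀ i, (prodG A B i).natDegree ≤ D := by
  intro i
  unfold prodG
  refine Fin.addCases (fun l => ?_) (fun l => ?_) i
  · rw [Fin.append_left]; exact (natDegree_add_le _ _).trans (max_le (hA l) (hB l))
  · rw [Fin.append_right]; exact (natDegree_sub_le _ _).trans (max_le (hA l) (hB l))

/-- **Kill criterion.**  If for every `δ > 0` and every `p₀` some prime `p ≥ p₀` admits a representation of its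
Fekete polynomial as `r` products `∑_{l<r} A_l B_l` with `r + r ≤ p^δ`, degrees `≤ p²` and
`2 ∑_l (|supp A_l| + |supp B_l|) < p^{1/2+δ}`, then the crux `FeketeSOSHard` is false.  (Rank-`r` factorisations of
tiling matrices `(χ_p(1+u+v))_{u ∈ S₁, v ∈ S₂}` are such representations with `|supp A_l| ≤ |S₁|`,
`|supp B_l| ≤ |S₂|`.)  No instance is known; see `Cruxes/FeketeSOSHard/Disproof.lean`. [folklore] -/
theorem feketeSOSHard_false_of_cheapProducts
    (h : ∀ δ : ℝ, 0 < δ → ∀ p₀ : ℕ, ∃ (p : ℕ) (_ : Fact p.Prime), p₀ ≤ p ∧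
      ∃ (r : ℕ) (A B : Fin r → ℂ[X]), ((r + r : ℕ) : ℝ) ≤ (p : ℝ) ^ δ ∧
        (∀ l, (A l).natDegree ≤ p ^ 2) ∧ (∀ l, (B l).natDegree ≤ p ^ 2) ∧
        (∑ l, A l * B l) = ∑ m ∈ range p, C ((legendreSym p m : ℤ) : ℂ) * X ^ m ∧
        2 * (∑ l, (((A l).support.card : ℝ) + (B l).support.card)) < (p : ℝ) ^ (1 / 2 + δ)) :
    ¬ FeketeSOSHard := by
  rintro ⟨δ, hδ, p₀, H⟩
  obtain ⟨p, hp, hp₀, r, A, B, hr, hA, hB, hsum, hsmall⟩ := h δ hδ p₀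
  have key := @H p hp hp₀ (r + r) (prodC r) (prodG A B) hr (prodG_natDegree A B _ hA hB)
    (by rw [prodG_sum, hsum])
  have := prodG_support A B
  linarith

end

end Summit.ValiantsHypothesis.ValiantsHypothesis.Theorems.FeketeSOSHard.Negative
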